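/-
Copyright: cell `pub-ymgap` (HUMAN RULING D-0062), Track A of `YM-PLAN.md`, DAG node N20 (= NE7b); R134 acceleration seat
`pub-ymgap-dag-n20-c` (strategy s1, generation 4), module 17.  Released under the licence of the surrounding project.
-/
import Literature.MathematicalPhysics.QuantumFieldTheory.Balaban1983to89.Node00.StepWeightsOfRecord
import HarnessLib

/-!
# YM-DAG node N20 (= NE7b), strategy s1, module 17: THE PINNED LARGE-FIELD LABELS OF BAŁABAN's STEP WEIGHTS OF RECORD —
# label-level POINTWISE EXTRACTION for the (3.2) and (3.3) decompositions of unity of [Balaban1988Convergent] p. 265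

Track A of `YM-PLAN.md` (cell `pub-ymgap`, HUMAN RULING D-0062), node **N20** = spine estimate NE7b (`T4WeightBudget.RelWeightBound` — the
cell `pub-balaban`'s OWN estimate, NOT PRINTED in [Bałaban 1983–89], NOT PROVED).  Seat `pub-ymgap-dag-n20-c` (R134, s1 «the `LocCondStability`
INSTANCE for Bałaban's tower at a pinned 𝐑𝐓 step»), generation 4, module 17.  Kernel theorems only: 0 `def`, 0 `sorry`, standard axioms;
COUNT-NEUTRAL; `--supports` the K3′ item.  Nothing of Bałaban's is asserted: the objects are NODE 00's STEP WEIGHTS OF RECORD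
(`Node00.StepWeightsOfRecord`: the labels `t = (P,Q,R,S)_{k+1}` of (3.2)·(3.3)·(3.16)·(3.20), the label weights `ωOfRecord A₁ ζ s t (U,V′) =
a(P)(V′)·b(P,Q)(U,V′)·ζ(R,S)(U,V′)` with the (3.2)·(3.3) factors PINNED and the fluctuation factor `ζ` RESIDUAL, resummed into `wOfRecord`), read BY NAME.

WHY.  Generations 0–3 of this seat typed the CARRIER side of «LCS-j» (`Spine/NE7b/LocalConditionalStability`): local exponential plaquette
moments at level 0 (module 7), their conditional ∕ restricted twins (modules 10–14), level 1 in the fine currency (modules 15–16).  The (α)-road's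
obligations, however, are indexed by PINNED LARGE-FIELD EVENTS (bad keys = genealogies of large-field activity): at a pinned step the road asks
`PointwiseExtraction` — the characteristic functions ∕ transition weights of the PINNED choices sum to at most `e^{−a}·M` — and `LocCondStability`
of `M`.  For NODE 00's T-step of record the transition weight of a new sequence `s′` is `χ_{k+1}(s′)(V′)·w(s′)(U,V′)` (module 3), `w = wOfRecord` the
resummation `Σ_{t : σ s t = s′} ω s t` over print's labels.  THIS FILE proves the first move of `PointwiseExtraction` AT THE RECORD, at the level of
the LABELS (finer than the tower's sequence index — the resummation `σ` forgets `P_{k+1}`): for every χ_{k+1}-cube `c`,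
* §1 **`sum_aWeight_filter_mem`**: `Σ_{P ∋ c} a(P)(V′) = 1 − χ_{k+1}(c)(V′)` on the (3.2) range (and `0` off it) — the decomposition of unity (3.2)
  summed over the labels whose NEW LARGE-FIELD FAMILY `P_{k+1}` contains `c` IS the complement factor `χᶜ_{k+1}(c)` (r11's `eq32`, punctured at `c`);
  **`sum_bWeight_filter_mem`**: the (3.3) twin `Σ_{Q ∋ c} b(P,Q) = 1 − χ′_k(c)` on the (3.3) range;
* **`abs_sum_ωOfRecord_filter_fst_le`** (★): modulo the DISPLAYED size law `IsZetaAbsLeOne` of the residual fluctuation factor,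
  `|Σ_{t : c ∈ P(t)} ω s t (U,V′)| ≤ 1 − χ_{k+1}(c)(V′)` pointwise in `(U, V′)`, at every step `k`, for every old sequence `s` — and the same with the
  new front factors in place (`abs_sum_front_ωOfRecord_filter_fst_le`; they are absorbed label by label, `front_mul_ωOfRecord`);
  **`abs_sum_ωOfRecord_filter_snd_le`**: `|Σ_{t : c ∈ Q(t)} ω s t (U,V′)| ≤ 1 − χ′_k(c)(U,V′)`.
The complement factor `1 − χ_{k+1}(c)` is exactly what print «estimates by exp(−p₀(g_j))» ([Balaban1989LargeFieldII] p. 383; [Balaban1989LargeFieldI]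
(0.1) p. 175); module 18 (`…N20LCSLargeFieldFirstStep`) turns it into a coarse large-field indicator under the regularity letter of
[Balaban1985PropagatorsII] Thm 1 and integrates it at the first step against `ρ₀` (n20-d's Peierls bound for the averaged field).
§0 is the finite-sum algebra (`Finset.prod_add` punctured at one index).

HONEST FRAMING.  Pointwise bookkeeping over NODE 00's definitions; the only analytic input is DISPLAYED (`IsZetaAbsLeOne` — print: the (3.16)·(3.20)
labels are mutually exclusive `{0,1}`-products; dischargeable when the minimiser of (3.10) has a body).  NOT HERE: the sequence-level (tower-index)
form of the pinned event (the collar labels `c ∉ P(t)`, `c ⊄ Ω_{k+1}(t)` carry no factor of `c` — their small factors come from NEARBY `P`∕`Q` cubes or are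
inherited from `Z_k`: the (α)-road's key-pattern READING, RR-1 ∕ (A1c)); the extraction of a small factor from `χ′ᶜ_k` ((3.12)–(3.19)); «LCS-j» at
`j ≥ 1`; the (α)-instance (NC-NE7b-α UNRULED).  NE7b NOT PRINTED ∕ NOT PROVED; N20 NOT discharged; typed 28∕28, discharged count untouched; one finite
four-torus at fixed `ε` — NOT ℝ⁴, NOT infinite volume, NOT OS, NOT a mass gap, NOT Clay.

References: T. Bałaban, CMP 119 (1988) 243–285 [Balaban1988Convergent] ((3.2)–(3.5) p. 265, (3.16) p. 268, (3.20)–(3.21) p. 269, §3 p. 267);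
CMP 122 (1989) 175–202 [Balaban1989LargeFieldI] ((0.1) p. 175, (1.22)–(1.28) pp. 181–183); CMP 122 (1989) 355–392 [Balaban1989LargeFieldII]
(p. 383); CMP 99 (1985) 389–434 [Balaban1985PropagatorsII] (Thm 1).
-/

set_option autoImplicit false

noncomputable section

open scoped BigOperators

namespace Summit.QuantumFields.YangMills.BalabanUVNodes.N20LCSLargeFieldLabels

open MeasureTheory
open Literature.MathematicalPhysics.QuantumFieldTheory.Balaban1983to89
open Literature.MathematicalPhysics.QuantumFieldTheory.Balaban1983to89.T4Continuum
open Literature.MathematicalPhysics.QuantumFieldTheory.Balaban1983to89.Node00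
open B14.Sect3Decomp

/-! ## §0 Two finite-sum identities (the punctured decompositions of unity) -/

section Algebra

variable {ι : Type*} [Fintype ι] [DecidableEq ι]

/-- **THE TWO-FACTOR EXPANSION SUMMED OVER ALL LABELS**: `Σ_X [X ⊆ C]·(Π_{C∖X} f)(Π_X g) = Π_C (g + f)` — the sum over all finite
label sets with the indicator of `· ⊆ C` is the sum over the powerset of `C`, and that is `Finset.prod_add`. [folklore] -/
theorem sum_ite_subset_prod_sdiff_mul_prod (C : Finset ι) (f g : ι → ℝ) :
    (∑ X : Finset ι, if X ⊆ C then (∏ i ∈ C \ X, f i) * ∏ i ∈ X, g i else 0) = ∏ i ∈ C, (g i + f i) := by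
  rw [← Finset.sum_filter, Finset.prod_add]
  refine Finset.sum_congr (by ext X; simp) fun X _ => mul_comm _ _

/-- **THE DECOMPOSITION OF UNITY SUMMED OVER THE LABELS AVOIDING A CUBE `c`.**  For weights `f, g` with `g + f = 1` on `C`:
`Σ_{X ⊆ C, c ∉ X} (Π_{C∖X} f)(Π_X g) = f c` if `c ∈ C` (the factor of `c` sits in every first product; the rest is the
decomposition of unity of `C ∖ {c}`), and `= 1` if `c ∉ C`. [folklore] -/
theorem sum_ite_not_mem_subset (C : Finset ι) (f g : ι → ℝ) (hfg : ∀ i ∈ C, g i + f i = 1) (c : ι) :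
    (∑ X : Finset ι, if c ∈ X then 0 else if X ⊆ C then (∏ i ∈ C \ X, f i) * ∏ i ∈ X, g i else 0) =
      if c ∈ C then f c else 1 := by
  by_cases hc : c ∈ C
  · rw [if_pos hc]
    have key : ∀ X : Finset ι,
        (if c ∈ X then (0 : ℝ) else if X ⊆ C then (∏ i ∈ C \ X, f i) * ∏ i ∈ X, g i else 0) =
          f c * (if X ⊆ C.erase c then (∏ i ∈ C.erase c \ X, f i) * ∏ i ∈ X, g i else 0) := by
      intro X
      by_cases hcX : c ∈ X
      · rw [if_pos hcX, if_neg, mul_zero]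
        exact fun h => Finset.notMem_erase c C (h hcX)
      · rw [if_neg hcX]
        by_cases hXC : X ⊆ C
        · have hXe : X ⊆ C.erase c := fun i hi =>
            Finset.mem_erase.2 ⟨fun h => hcX (h ▸ hi), hXC hi⟩
          rw [if_pos hXC, if_pos hXe]
          have hsd : C \ X = insert c (C.erase c \ X) := by
            rw [← Finset.insert_sdiff_of_notMem _ hcX, Finset.insert_erase hc]
          rw [hsd, Finset.prod_insert (fun h => Finset.notMem_erase c C (Finset.mem_sdiff.1 h).1), mul_assoc]
        · rw [if_neg hXC, if_neg, mul_zero]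
          exact fun h => hXC (h.trans (Finset.erase_subset c C))
    simp_rw [key]
    rw [← Finset.mul_sum, sum_ite_subset_prod_sdiff_mul_prod,
      Finset.prod_eq_one fun i hi => hfg i (Finset.mem_of_mem_erase hi), mul_one]
  · rw [if_neg hc]
    have key : ∀ X : Finset ι,
        (if c ∈ X then (0 : ℝ) else if X ⊆ C then (∏ i ∈ C \ X, f i) * ∏ i ∈ X, g i else 0) =
          if X ⊆ C then (∏ i ∈ C \ X, f i) * ∏ i ∈ X, g i else 0 := by
      intro X
      by_cases hcX : c ∈ X
      · rw [if_pos hcX, if_neg]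
        exact fun h => hc (h hcX)
      · rw [if_neg hcX]
    simp_rw [key]
    rw [sum_ite_subset_prod_sdiff_mul_prod, Finset.prod_eq_one hfg]

/-- **THE DECOMPOSITION OF UNITY SUMMED OVER THE LABELS CONTAINING A CUBE `c`** (`g + f = 1` on `C`):
`Σ_{X ⊆ C, c ∈ X} (Π_{C∖X} f)(Π_X g) = g c` if `c ∈ C`, and `= 0` if `c ∉ C`. [folklore] -/
theorem sum_ite_mem_subset (C : Finset ι) (f g : ι → ℝ) (hfg : ∀ i ∈ C, g i + f i = 1) (c : ι) :
    (∑ X : Finset ι, if c ∈ X then (if X ⊆ C then (∏ i ∈ C \ X, f i) * ∏ i ∈ X, g i else 0) else 0) =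
      if c ∈ C then g c else 0 := by
  have htot : (∑ X : Finset ι, if X ⊆ C then (∏ i ∈ C \ X, f i) * ∏ i ∈ X, g i else 0) = 1 := by
    rw [sum_ite_subset_prod_sdiff_mul_prod, Finset.prod_eq_one hfg]
  have hsplit : ∀ X : Finset ι,
      (if c ∈ X then (if X ⊆ C then (∏ i ∈ C \ X, f i) * ∏ i ∈ X, g i else 0) else 0) =
        (if X ⊆ C then (∏ i ∈ C \ X, f i) * ∏ i ∈ X, g i else 0) -
          (if c ∈ X then 0 else if X ⊆ C then (∏ i ∈ C \ X, f i) * ∏ i ∈ X, g i else 0) := by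
    intro X
    split_ifs <;> ring
  simp_rw [hsplit]
  rw [Finset.sum_sub_distrib, htot, sum_ite_not_mem_subset C f g hfg c]
  by_cases hc : c ∈ C
  · rw [if_pos hc, if_pos hc, ← hfg c hc]
    ring
  · rw [if_neg hc, if_neg hc, sub_self]

end Algebra

/-! ## §1 The pinned label sums of the step weights of record, POINTWISE in `(U, V′)` -/

section Labels

variable (F : T4Family) (N : ℕ) [NeZero N] (ν : Stage7Numerics) (M : ℕ) (p : B12.RunParams) (g : ℕ → ℝ) (k : ℕ)

/-- r11's `χᶜ_{k+1}(X)` on the pinned data is the product of the complement factors `1 − χ_{k+1}(□)` of record. [folklore] -/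
theorem chiNextc_sect3DataOfRecord (s : SeqOfRecord F ν M g p.K k) (X : Finset (Iχ F ν p g k))
    (V' : GaugeField (F.P p.K) (k + 1) (SU N)) :
    chiNextc (sect3DataOfRecord F N ν M p g k s) (epsOfRecord ν g (k + 1)) X V' =
      ∏ c ∈ X, (1 - chiFactor F N ν p g k c V') :=
  rfl

/-- The (3.2) label weight unfolded: `a(P)(V′) = [P ⊆ (3.2)-range]·Π_{□∈range∖P} χ(□)(V′)·Π_{□∈P}(1 − χ(□)(V′))`. [folklore] -/
theorem aWeight_eq (s : SeqOfRecord F ν M g p.K k) (Pl : Finset (Iχ F ν p g k))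
    (V' : GaugeField (F.P p.K) (k + 1) (SU N)) :
    aWeight F N ν M p g k s Pl V' =
      if Pl ⊆ cubes32 F ν M p g k s then
        (∏ c ∈ cubes32 F ν M p g k s \ Pl, chiFactor F N ν p g k c V') * ∏ c ∈ Pl, (1 - chiFactor F N ν p g k c V')
      else 0 := by
  unfold aWeight
  rw [chiNext_sect3DataOfRecord, chiNextc_sect3DataOfRecord]

/-- **THE (3.2) LABELS PINNED AT A CUBE SUM TO ITS COMPLEMENT FACTOR.**  For every χ_{k+1}-cube `c`:
`Σ_{P ∋ c} a(P)(V′) = 1 − χ_{k+1}(c)(V′)` if `c` lies in the (3.2) range `(Z̃_k^{∼4})ᶜ`, and `= 0` otherwise — the punctured decomposition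
of unity (3.2) ([Balaban1988Convergent] p. 265; r11's `eq32` on `range ∖ {c}`). [folklore] -/
theorem sum_aWeight_filter_mem (s : SeqOfRecord F ν M g p.K k) (c : Iχ F ν p g k)
    (V' : GaugeField (F.P p.K) (k + 1) (SU N)) :
    ∑ Pl ∈ Finset.univ.filter (fun Pl : Finset (Iχ F ν p g k) => c ∈ Pl), aWeight F N ν M p g k s Pl V' =
      if c ∈ cubes32 F ν M p g k s then 1 - chiFactor F N ν p g k c V' else 0 := by
  rw [Finset.sum_filter]
  simp_rw [aWeight_eq]
  exact sum_ite_mem_subset (cubes32 F ν M p g k s) (fun c => chiFactor F N ν p g k c V')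
    (fun c => 1 - chiFactor F N ν p g k c V') (fun _ _ => by ring) c

/-- The pinned (3.2) sum is between `0` and `1 − χ_{k+1}(c)(V′) ≤ 1`. [folklore] -/
theorem sum_aWeight_filter_mem_le (s : SeqOfRecord F ν M g p.K k) (c : Iχ F ν p g k)
    (V' : GaugeField (F.P p.K) (k + 1) (SU N)) :
    ∑ Pl ∈ Finset.univ.filter (fun Pl : Finset (Iχ F ν p g k) => c ∈ Pl), aWeight F N ν M p g k s Pl V' ≤
      1 - chiFactor F N ν p g k c V' := by
  rw [sum_aWeight_filter_mem]
  split_ifs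
  · exact le_rfl
  · exact sub_nonneg.2 (chiFactor_le_one F N ν p g k c V')

open Classical in
/-- **THE (3.3) LABELS PINNED AT A CUBE SUM TO ITS COMPLEMENT FACTOR.**  For every `P_{k+1}` and every χ_{k+1}-cube `c`:
`Σ_{Q ∋ c} b(P,Q)(U,V′) = 1 − χ′_k(c)(U,V′)` if `c` lies in the (3.3) range `(B^{k+1}(P¹_{k+1}))^{∼−1}`, and `= 0` otherwise, where
`χ′_k(c)(U,V′) = 𝟙[sup_{b∈(c^{∼2})^{(k)*}}|U(b)(V^{(k)}_{c}(b))⁻¹ − 1| < 2δ_k]` is r11's one-cube (3.3) factor (`SmallApproxFluct` at the averaging of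
record, `2δ_k = 2·deltaOfRecord`) ([Balaban1988Convergent] (3.3) p. 265; r11's `eq33`, punctured). [folklore] -/
theorem sum_bWeight_filter_mem (A₁ : ℝ) (s : SeqOfRecord F ν M g p.K k) (Pl : Finset (Iχ F ν p g k)) (c : Iχ F ν p g k)
    (U : GaugeField (F.P p.K) k (SU N)) (V' : GaugeField (F.P p.K) (k + 1) (SU N)) :
    ∑ Ql ∈ Finset.univ.filter (fun Ql : Finset (Iχ F ν p g k) => c ∈ Ql), bWeight F N ν M p g k A₁ s Pl Ql U V' =
      if c ∈ qcubes F ν M p g k s Pl then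
        1 - (if SmallApproxFluct (sect3DataOfRecord F N ν M p g k s) (avOfRecord F N p.K) (2 * deltaOfRecord ν g k A₁) U V' c
          then (1 : ℝ) else 0)
      else 0 := by
  rw [Finset.sum_filter]
  unfold bWeight chiPrime chiPrimec
  have h := sum_ite_mem_subset (qcubes F ν M p g k s Pl)
    (fun c => if SmallApproxFluct (sect3DataOfRecord F N ν M p g k s) (avOfRecord F N p.K)
      (2 * deltaOfRecord ν g k A₁) U V' c then (1 : ℝ) else 0)
    (fun c => if SmallApproxFluct (sect3DataOfRecord F N ν M p g k s) (avOfRecord F N p.K)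
      (2 * deltaOfRecord ν g k A₁) U V' c then (0 : ℝ) else 1) (fun c _ => by split_ifs <;> norm_num) c
  refine h.trans ?_
  split_ifs <;> norm_num

/-- **FRONT-FACTOR ABSORPTION, label by label**: `χ_{k+1}(Ω_{k+1}(t))(V′)·ω s t (U,V′) = ω s t (U,V′)`
(`StepWeightsOfRecord.front_absorb`). [folklore] -/
theorem front_mul_ωOfRecord (A₁ : ℝ) (ζ : ZetaOfRecord F N ν M) (s : SeqOfRecord F ν M g p.K k) (t : LbOfRecord F ν p g k)
    (U : GaugeField (F.P p.K) k (SU N)) (V' : GaugeField (F.P p.K) (k + 1) (SU N)) :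
    chiSeqOfRecord F N ν M g p.K (k + 1) (σOfRecord F ν M p g k s t) V' * ωOfRecord F N ν M p g k A₁ ζ s t U V' =
      ωOfRecord F N ν M p g k A₁ ζ s t U V' := by
  rw [ωOfRecord, ← mul_assoc, ← mul_assoc, front_absorb, mul_assoc]

/-- `|ω s t| = a(P)·b(P,Q)·|ζ(R,S)|` (the two pinned factors are non-negative). [folklore] -/
theorem abs_ωOfRecord (A₁ : ℝ) (ζ : ZetaOfRecord F N ν M) (s : SeqOfRecord F ν M g p.K k) (t : LbOfRecord F ν p g k)
    (U : GaugeField (F.P p.K) k (SU N)) (V' : GaugeField (F.P p.K) (k + 1) (SU N)) :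
    |ωOfRecord F N ν M p g k A₁ ζ s t U V'| =
      aWeight F N ν M p g k s t.1 V' * (bWeight F N ν M p g k A₁ s t.1 t.2.1 U V' * |ζ p g k s t.1 t.2.1 t.2.2 U V'|) := by
  rw [ωOfRecord, abs_mul, abs_mul, abs_of_nonneg (aWeight_nonneg F N ν M p g k s t.1 V'),
    abs_of_nonneg (bWeight_nonneg F N ν M p g k A₁ s t.1 t.2.1 U V'), mul_assoc]

/-- **LABEL-LEVEL POINTWISE EXTRACTION FOR A PINNED (3.2) LARGE-FIELD CUBE.**  Modulo the displayed size law of the residual fluctuation factor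
(`IsZetaAbsLeOne`), for every old sequence `s`, every χ_{k+1}-cube `c` and all fields `(U, V′)`, the step weights of record of the labels
`t = (P,Q,R,S)_{k+1}` whose NEW LARGE-FIELD FAMILY `P_{k+1}` CONTAINS `c` have total size at most the complement factor of `c`:
`|Σ_{t : c ∈ P(t)} ω s t (U,V′)| ≤ 1 − χ_{k+1}(c)(V′)` — the (3.2) factor `χᶜ_{k+1}(c)` that print estimates by `exp(−p₀(g_k))`
([Balaban1989LargeFieldII] p. 383 «we estimate the factors by exp(−p₀(g_j))»; half (i) of «LCS-j» at the FINER index of the labels — the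
tower's choice index is the resummed sequence `σ s t`). [folklore] -/
theorem abs_sum_ωOfRecord_filter_fst_le (A₁ : ℝ) {ζ : ZetaOfRecord F N ν M} (hζ : IsZetaAbsLeOne F N ν M ζ)
    (s : SeqOfRecord F ν M g p.K k) (c : Iχ F ν p g k)
    (U : GaugeField (F.P p.K) k (SU N)) (V' : GaugeField (F.P p.K) (k + 1) (SU N)) :
    |∑ t ∈ Finset.univ.filter (fun t : LbOfRecord F ν p g k => c ∈ t.1), ωOfRecord F N ν M p g k A₁ ζ s t U V'| ≤
      1 - chiFactor F N ν p g k c V' := by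
  classical
  -- the pinned indicator of the (3.2) weight
  set aPin : Finset (Iχ F ν p g k) → ℝ := fun Pl => if c ∈ Pl then aWeight F N ν M p g k s Pl V' else 0 with haPin
  have haPin0 : ∀ Pl, 0 ≤ aPin Pl := fun Pl => by
    simp only [haPin]; split_ifs
    · exact aWeight_nonneg F N ν M p g k s Pl V'
    · exact le_rfl
  have hz : ∀ Pl Ql : Finset (Iχ F ν p g k), ∑ R, ∑ S, |ζ p g k s Pl Ql (R, S) U V'| ≤ 1 := fun Pl Ql => by
    have h := hζ p g k s Pl Ql U V'
    rwa [Fintype.sum_prod_type] at h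
  have key : ∀ t : LbOfRecord F ν p g k,
      (if c ∈ t.1 then |ωOfRecord F N ν M p g k A₁ ζ s t U V'| else 0) =
        aPin t.1 * (bWeight F N ν M p g k A₁ s t.1 t.2.1 U V' * |ζ p g k s t.1 t.2.1 t.2.2 U V'|) := by
    intro t
    simp only [haPin]
    split_ifs
    · exact abs_ωOfRecord F N ν M p g k A₁ ζ s t U V'
    · rw [zero_mul]
  calc |∑ t ∈ Finset.univ.filter (fun t : LbOfRecord F ν p g k => c ∈ t.1), ωOfRecord F N ν M p g k A₁ ζ s t U V'|
      ≤ ∑ t ∈ Finset.univ.filter (fun t : LbOfRecord F ν p g k => c ∈ t.1), |ωOfRecord F N ν M p g k A₁ ζ s t U V'| :=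
        Finset.abs_sum_le_sum_abs _ _
    _ = ∑ t : LbOfRecord F ν p g k, aPin t.1 * (bWeight F N ν M p g k A₁ s t.1 t.2.1 U V' * |ζ p g k s t.1 t.2.1 t.2.2 U V'|) := by
        rw [Finset.sum_filter]
        exact Finset.sum_congr rfl fun t _ => key t
    _ = ∑ Pl, ∑ Ql, ∑ R, ∑ S, aPin Pl * (bWeight F N ν M p g k A₁ s Pl Ql U V' * |ζ p g k s Pl Ql (R, S) U V'|) := by
        simp only [Fintype.sum_prod_type]
    _ = ∑ Pl, aPin Pl * ∑ Ql, bWeight F N ν M p g k A₁ s Pl Ql U V' * ∑ R, ∑ S, |ζ p g k s Pl Ql (R, S) U V'| := by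
        simp only [Finset.mul_sum]
    _ ≤ ∑ Pl, aPin Pl * ∑ Ql, bWeight F N ν M p g k A₁ s Pl Ql U V' * 1 := by
        refine Finset.sum_le_sum fun Pl _ => mul_le_mul_of_nonneg_left ?_ (haPin0 Pl)
        exact Finset.sum_le_sum fun Ql _ =>
          mul_le_mul_of_nonneg_left (hz Pl Ql) (bWeight_nonneg F N ν M p g k A₁ s Pl Ql U V')
    _ = ∑ Pl ∈ Finset.univ.filter (fun Pl : Finset (Iχ F ν p g k) => c ∈ Pl), aWeight F N ν M p g k s Pl V' := by
        simp only [mul_one, sum_bWeight, haPin]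
        rw [Finset.sum_filter]
    _ ≤ 1 - chiFactor F N ν p g k c V' := sum_aWeight_filter_mem_le F N ν M p g k s c V'

/-- The same with the new front factors in place (they are absorbed label by label): `|Σ_{t : c ∈ P(t)} χ_{k+1}(σ s t)(V′)·ω s t (U,V′)| ≤
1 − χ_{k+1}(c)(V′)`. [folklore] -/
theorem abs_sum_front_ωOfRecord_filter_fst_le (A₁ : ℝ) {ζ : ZetaOfRecord F N ν M} (hζ : IsZetaAbsLeOne F N ν M ζ)
    (s : SeqOfRecord F ν M g p.K k) (c : Iχ F ν p g k)
    (U : GaugeField (F.P p.K) k (SU N)) (V' : GaugeField (F.P p.K) (k + 1) (SU N)) :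
    |∑ t ∈ Finset.univ.filter (fun t : LbOfRecord F ν p g k => c ∈ t.1),
        chiSeqOfRecord F N ν M g p.K (k + 1) (σOfRecord F ν M p g k s t) V' * ωOfRecord F N ν M p g k A₁ ζ s t U V'| ≤
      1 - chiFactor F N ν p g k c V' := by
  simp_rw [front_mul_ωOfRecord]
  exact abs_sum_ωOfRecord_filter_fst_le F N ν M p g k A₁ hζ s c U V'

open Classical in
/-- **LABEL-LEVEL POINTWISE EXTRACTION FOR A PINNED (3.3) CUBE** (the approximate-fluctuation restriction `χ′ᶜ_k`): modulo `IsZetaAbsLeOne`,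
`|Σ_{t : c ∈ Q(t)} ω s t (U,V′)| ≤ 1 − χ′_k(c)(U,V′)` — the labels whose (3.3) family `Q_{k+1}` contains `c` weigh at most the complement
factor of `c` ([Balaban1988Convergent] (3.3) p. 265; its small factor is extracted in print through (3.12)–(3.19), NOT here). [folklore] -/
theorem abs_sum_ωOfRecord_filter_snd_le (A₁ : ℝ) {ζ : ZetaOfRecord F N ν M} (hζ : IsZetaAbsLeOne F N ν M ζ)
    (s : SeqOfRecord F ν M g p.K k) (c : Iχ F ν p g k)
    (U : GaugeField (F.P p.K) k (SU N)) (V' : GaugeField (F.P p.K) (k + 1) (SU N)) :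
    |∑ t ∈ Finset.univ.filter (fun t : LbOfRecord F ν p g k => c ∈ t.2.1), ωOfRecord F N ν M p g k A₁ ζ s t U V'| ≤
      1 - (if SmallApproxFluct (sect3DataOfRecord F N ν M p g k s) (avOfRecord F N p.K) (2 * deltaOfRecord ν g k A₁) U V' c
        then (1 : ℝ) else 0) := by
  -- the one-cube (3.3) factor
  set χ' : ℝ := (if SmallApproxFluct (sect3DataOfRecord F N ν M p g k s) (avOfRecord F N p.K) (2 * deltaOfRecord ν g k A₁) U V' c
    then (1 : ℝ) else 0) with hχ'
  set bPin : Finset (Iχ F ν p g k) → Finset (Iχ F ν p g k) → ℝ :=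
    fun Pl Ql => if c ∈ Ql then bWeight F N ν M p g k A₁ s Pl Ql U V' else 0 with hbPin
  have hbPin0 : ∀ Pl Ql, 0 ≤ bPin Pl Ql := fun Pl Ql => by
    simp only [hbPin]; split_ifs
    · exact bWeight_nonneg F N ν M p g k A₁ s Pl Ql U V'
    · exact le_rfl
  have hz : ∀ Pl Ql : Finset (Iχ F ν p g k), ∑ R, ∑ S, |ζ p g k s Pl Ql (R, S) U V'| ≤ 1 := fun Pl Ql => by
    have h := hζ p g k s Pl Ql U V'
    rwa [Fintype.sum_prod_type] at h
  have hχ1 : χ' ≤ 1 := by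
    rw [hχ']; split_ifs <;> norm_num
  have hB : ∀ Pl, ∑ Ql, bPin Pl Ql ≤ 1 - χ' := by
    intro Pl
    have h := sum_bWeight_filter_mem F N ν M p g k A₁ s Pl c U V'
    rw [Finset.sum_filter] at h
    simp only [hbPin]
    rw [h]
    by_cases hc : c ∈ qcubes F ν M p g k s Pl
    · rw [if_pos hc, ← hχ']
    · rw [if_neg hc]
      exact sub_nonneg.2 hχ1
  have key : ∀ t : LbOfRecord F ν p g k,
      (if c ∈ t.2.1 then |ωOfRecord F N ν M p g k A₁ ζ s t U V'| else 0) =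
        aWeight F N ν M p g k s t.1 V' * (bPin t.1 t.2.1 * |ζ p g k s t.1 t.2.1 t.2.2 U V'|) := by
    intro t
    simp only [hbPin]
    split_ifs
    · exact abs_ωOfRecord F N ν M p g k A₁ ζ s t U V'
    · rw [zero_mul, mul_zero]
  calc |∑ t ∈ Finset.univ.filter (fun t : LbOfRecord F ν p g k => c ∈ t.2.1), ωOfRecord F N ν M p g k A₁ ζ s t U V'|
      ≤ ∑ t ∈ Finset.univ.filter (fun t : LbOfRecord F ν p g k => c ∈ t.2.1), |ωOfRecord F N ν M p g k A₁ ζ s t U V'| :=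
        Finset.abs_sum_le_sum_abs _ _
    _ = ∑ t : LbOfRecord F ν p g k, aWeight F N ν M p g k s t.1 V' * (bPin t.1 t.2.1 * |ζ p g k s t.1 t.2.1 t.2.2 U V'|) := by
        rw [Finset.sum_filter]
        exact Finset.sum_congr rfl fun t _ => key t
    _ = ∑ Pl, ∑ Ql, ∑ R, ∑ S, aWeight F N ν M p g k s Pl V' * (bPin Pl Ql * |ζ p g k s Pl Ql (R, S) U V'|) := by
        simp only [Fintype.sum_prod_type]
    _ = ∑ Pl, aWeight F N ν M p g k s Pl V' * ∑ Ql, bPin Pl Ql * ∑ R, ∑ S, |ζ p g k s Pl Ql (R, S) U V'| := by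
        simp only [Finset.mul_sum]
    _ ≤ ∑ Pl, aWeight F N ν M p g k s Pl V' * ∑ Ql, bPin Pl Ql * 1 := by
        refine Finset.sum_le_sum fun Pl _ => mul_le_mul_of_nonneg_left ?_ (aWeight_nonneg F N ν M p g k s Pl V')
        exact Finset.sum_le_sum fun Ql _ => mul_le_mul_of_nonneg_left (hz Pl Ql) (hbPin0 Pl Ql)
    _ ≤ ∑ Pl, aWeight F N ν M p g k s Pl V' * (1 - χ') := by
        simp only [mul_one]
        exact Finset.sum_le_sum fun Pl _ => mul_le_mul_of_nonneg_left (hB Pl) (aWeight_nonneg F N ν M p g k s Pl V')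
    _ = 1 - χ' := by
        rw [← Finset.sum_mul, sum_aWeight, one_mul]

/-- **BOTH PINNED SUMS ARE AT MOST ONE** (in particular the P-pinned sum vanishes where `χ_{k+1}(c)(V′) = 1` and the Q-pinned sum where
`χ′_k(c)(U,V′) = 1`). [folklore] -/
theorem abs_sum_ωOfRecord_filter_fst_le_one (A₁ : ℝ) {ζ : ZetaOfRecord F N ν M} (hζ : IsZetaAbsLeOne F N ν M ζ)
    (s : SeqOfRecord F ν M g p.K k) (c : Iχ F ν p g k)
    (U : GaugeField (F.P p.K) k (SU N)) (V' : GaugeField (F.P p.K) (k + 1) (SU N)) :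
    |∑ t ∈ Finset.univ.filter (fun t : LbOfRecord F ν p g k => c ∈ t.1), ωOfRecord F N ν M p g k A₁ ζ s t U V'| ≤ 1 :=
  (abs_sum_ωOfRecord_filter_fst_le F N ν M p g k A₁ hζ s c U V').trans
    (sub_le_self _ (chiFactor_nonneg F N ν p g k c V'))

end Labels

end Summit.QuantumFields.YangMills.BalabanUVNodes.N20LCSLargeFieldLabels

end

/-! ### Erratum (g4, 2026-08-27) — citation pointer, prose only
In the prose of this file «[Balaban1985PropagatorsII] Thm 1» ∕ «CMP 99 (1985) 389–434» denotes T. Bałaban, *The variational problem and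
background fields in renormalization group method for lattice gauge theories*, Commun. Math. Phys. **102** (1985) 277–309 — bib key
`Balaban1985Variational` —, Theorem 1 p. 279 (for data with `|∂V(p′) − 1| < ε₁ ≤ a₁` there is a minimal orbit in
`U_k({𝔅_j}, B₃ε₁) ∩ 𝔘_k(𝔅_k, V)`, the unique critical orbit for `B₃ε₁ ≤ ε₀ ≤ a₀`, with the local regularity (9)–(10)); there is no bib key
`Balaban1985PropagatorsII`.  The regularity letter `hreg` is that theorem's shape at def-R's (2.16) problem.  Statements are unaffected. -/
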